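import Summits.QuantumFields.YangMills.Theorems.UnitScaleTiltProp7BlendedGauge
import Summits.QuantumFields.YangMills.Theorems.UnitScaleTiltProp7TPrintDefs
import Literature.MathematicalPhysics.QuantumFieldTheory.Balaban1983to89.BlockAveragingFederbushRadiusExact
import Literature.MathematicalPhysics.QuantumFieldTheory.Balaban1983to89.T4WilsonGaugeFlatDirection
import HarnessLib

/-!
# Route `UnitScaleTilt`, crux K1 child «MinimiserStabilityRegPr» (stmt-QuantumFields-19200), route-R ∕ α-P second line, E′ growth side under
# ★★OWNER RULING g27-№8 «UNTWISTED (U2)» — THE UNTWISTED CHART OF AN ARBITRARY COMPETITOR FROM THE BLENDED COMB GAUGE: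
# rows (i) sup `‖D b‖ ≤ 2204352·e·L^{−(K−n)}`, (ii) `A(W′) = A(e^{iD}W)`, (iii) `e^{iD}W ∈ (6)(e) ∩ 𝔅_k(V)` of the E′ text of record, for EVERY `W′ ∈ (6)(e) ∩ 𝔅_k(V)`

Cell `ym3-torus` ∕ width seat `ym-ust-19200-w1` (gen 11; R2 (c) hand per ★★OWNER RULING g27-№8 (2)).  THEOREMS ONLY (0 `def`, 0 `sorry`); `--supports
stmt-QuantumFields-19200`, count-neutral.  YM₃ on T³ is a ladder rung (R3), not the Clay problem; nothing here claims the stub, the crux, d = 4 or the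
mass gap; E′ is NOT closed by this file.

WHY.  The E′ text of record ✓`Prop7LocMinOfGaugedRows116Text.stub_PV3E_of_fibreRows` (:95–:98) asks, per competitor `W′ ∈ (6)(e) ∩ 𝔅_k(V)` of the R2-critical
`W ∈ (6)(e) ∩ 𝔅_k(V)`, for a Hermitian-traceless bond field `D` with (i) `‖D b‖ ≤ s₀·ℓ⁻¹` (`ℓ = L^{K−n}`), (ii) `wilsonAction4 W′ = wilsonAction4 (emb15 W (expHermField D))`,
(iii) `emb15 W (expHermField D) ∈ 𝔅_k(V)` (UNTWISTED membership) — plus the SLICE and JOINT rows, which this file does not touch.  Rows (i)–(iii) need neither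
the Thm-2 socket nor print's twisted Landau representative: gen 9's blended comb gauge ✓`Prop7BlendedGauge.exists_blendedGauge_T3`, applied to the PAIR
(`U₀ :=` the minimiser `W`, `W :=` the competitor `W′`) — two elements of the same regular fibre — gives a gauge transformation `g` of print's group (4)
(`g↓ = 1`, so `W′^g` stays in `(6)(e) ∩ 𝔅_k(V)`) with `‖(W′^g)_b·W_b⁻¹ − 1‖ ≤ 551088·2e·L^{−(K−n)}` on EVERY bond, `k`-uniformly; the Hermitian logarithm
`D b := (−i)·log((W′^g)_b·W_b⁻¹)` is then the chart exponent: Hermitian ([BlockAveragingFederbushRadiusExact] `isHermitian_negI_smul_mlog`), traceless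
(`ExpMeanLog.trace_mlog_eq_zero_of_det_eq_one`), `e^{iD_b}·W_b = (W′^g)_b` (`MatrixLog.exp_mlog`), `‖D b‖ ≤ 2‖(W′^g)_b W_b⁻¹ − 1‖` (`MatrixLog.norm_mlog_le_two_mul`),
and `A(W′) = A(W′^g)` by gauge invariance ([T4WilsonGaugeFlatDirection] `wilsonAction_gaugeAct`).  The representative lies in the same pinned orbit as
★p1 g14's `X^g` of ✓`Prop7TwistRegauge.exists_untwistedRegauge_T3` (`X^g = (X^u)^{g·u⁻¹}`, `(g·u⁻¹)↓ = 1`).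

WHAT IS PROVED (ns `…Theorems.Prop7UntwistedChartOfBlend`).  §1 `hermLog_isHermitian`, `hermLog_trace`, `norm_hermLog_le`, `exp_I_smul_hermLog`,
`expHerm_hermLog` (the Hermitian logarithm of a special unitary within `1∕3` of `1`); §2 ★★ `exists_untwistedChart_of_regFibrePr` (rows (i)(ii)(iii) with the
absolute constant `2204352·e`), ★ `exists_untwistedChart_rows` (the same in the letters of the E′ text: `‖D b‖ ≤ s₀·((F.L)^{K−n})⁻¹` for any `s₀ ≥ 2204352·e`,
membership in `fibre F ℰp n K h V`).

HONEST SCOPE.  Bookkeeping over gen 9's blend; the SLICE row (iv) of the E′ text is NOT supplied — for this `D` its divergence is uncontrolled (LOCATE memo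
`LOCATE-R2-UNTWIST-w1g11.md`, 19200 evidence #54, §3: the E′ window forces `δ₀ ≤ 4κ_H = 1∕(32(18+537600L⁴))`, so (iv) needs a slice, not a comparison row);
the JOINT row (v) is F5's (`…Prop7JointRowOfSuppliers`) on (i)+(iii).  Count-neutral helper toward stmt-QuantumFields-19200 (`--supports`).

References: T. Bałaban, CMP 102 (1985) 277–309 [Balaban1985Variational] ((4)–(6) p.278, (15) p.280, (18) p.280, (112) p.294, (141)–(143) p.299);
CMP 99 (1985) 75–102 [Balaban1985RegularSpaces] (Lemma 1 p.79, p.80); CMP 98 (1985) 17–51 [Balaban1985Averaging] ((19)–(21) p.21).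
-/

noncomputable section

open NormedSpace
open scoped Matrix.Norms.L2Operator

namespace Summit.QuantumFields.YangMills.Theorems.Prop7UntwistedChartOfBlend

open Literature.MathematicalPhysics.QuantumFieldTheory.Balaban1983to89
open T4Continuum
open MatrixLog (mlog exp_mlog norm_mlog_le_two_mul)
open ExpMeanLog (trace_mlog_eq_zero_of_det_eq_one)
open FederbushMean (isHermitian_negI_smul_mlog)
open Literature.MathematicalPhysics.QuantumFieldTheory.Balaban1983to89.T3ContinuumYM3Torus
open Literature.MathematicalPhysics.QuantumFieldTheory.Balaban1983to89.T3UnitLawDensityEML (ℰp)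
open Literature.MathematicalPhysics.QuantumFieldTheory.Balaban1983to89.T3ConstrainedMinimiser (fibre)
open Literature.MathematicalPhysics.QuantumFieldTheory.Balaban1983to89.T3PrintedRegularMinimiser (regFibrePr mem_regFibrePr_iff)
open Literature.MathematicalPhysics.QuantumFieldTheory.Balaban1983to89.T3SectALandauChart (emb15 pos_of_regPr)
open BlockAveragingEMLLinearisedBackground (pertVar)
open Summit.QuantumFields.YangMills.Theorems.Prop7TPrint (expHerm expHermField coe_expHerm expHermField_apply)
open Summit.QuantumFields.YangMills.Theorems.Prop7BlendedGauge (exists_blendedGauge_T3)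

/-! ## §1 The Hermitian logarithm of a special unitary near `1` -/

section HermLog

/-- `−i·log Q` is Hermitian for unitary `Q` within `1∕3` of `1`. [cite: Balaban1985Averaging, (19)-(21) p.21] -/
theorem hermLog_isHermitian {Q : Matrix (Fin 2) (Fin 2) ℂ} (hQ : Q ∈ Matrix.unitaryGroup (Fin 2) ℂ) (hs : ‖Q - 1‖ ≤ 1 / 3) :
    ((-Complex.I) • mlog Q).IsHermitian :=
  isHermitian_negI_smul_mlog hQ hs

/-- `−i·log Q` is traceless for `det Q = 1`, `‖Q − 1‖ ≤ 1∕3`. [cite: Balaban1985Averaging, (19)-(21) p.21] -/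
theorem hermLog_trace {Q : Matrix (Fin 2) (Fin 2) ℂ} (hdet : Q.det = 1) (hs : ‖Q - 1‖ ≤ 1 / 3) :
    ((-Complex.I) • mlog Q).trace = 0 := by
  have hπ : (Fintype.card (Fin 2) : ℝ) * ‖Q - 1‖ < Real.pi := by
    rw [Fintype.card_fin]; push_cast
    have := Real.pi_gt_three
    nlinarith [norm_nonneg (Q - 1)]
  rw [Matrix.trace_smul, trace_mlog_eq_zero_of_det_eq_one hdet hs hπ, smul_zero]

/-- `‖−i·log Q‖ ≤ 2‖Q − 1‖` for `‖Q − 1‖ ≤ 1∕2`. [cite: Balaban1985Averaging, (21) p.21] -/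
theorem norm_hermLog_le {Q : Matrix (Fin 2) (Fin 2) ℂ} (hs : ‖Q - 1‖ ≤ 1 / 2) :
    ‖(-Complex.I) • mlog Q‖ ≤ 2 * ‖Q - 1‖ := by
  rw [norm_smul, norm_neg, Complex.norm_I, one_mul]
  exact norm_mlog_le_two_mul hs

/-- `exp(i·(−i·log Q)) = Q` for `‖Q − 1‖ < 1`. [cite: Balaban1985Averaging, (19)-(21) p.21] -/
theorem exp_I_smul_hermLog {Q : Matrix (Fin 2) (Fin 2) ℂ} (hs : ‖Q - 1‖ < 1) :
    exp (Complex.I • ((-Complex.I) • mlog Q)) = Q := by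
  rw [smul_smul, show Complex.I * -Complex.I = 1 by rw [mul_neg, Complex.I_mul_I, neg_neg], one_smul]
  exact exp_mlog hs

/-- **`expHerm` INVERTS THE HERMITIAN LOGARITHM**: for `Q ∈ SU(2)` with `‖↑Q − 1‖ ≤ 1∕3`, `expHerm(−i·log ↑Q) = Q`.
[cite: Balaban1985Variational, (112) p.294; Balaban1985Averaging, (19)-(21) p.21] -/
theorem expHerm_hermLog (Q : Matrix.specialUnitaryGroup (Fin 2) ℂ) (hs : ‖(Q : Matrix (Fin 2) (Fin 2) ℂ) - 1‖ ≤ 1 / 3) :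
    expHerm ((-Complex.I) • mlog (Q : Matrix (Fin 2) (Fin 2) ℂ)) = Q := by
  have hQ := Matrix.mem_specialUnitaryGroup_iff.1 Q.2
  apply Subtype.ext
  rw [coe_expHerm ⟨hermLog_isHermitian hQ.1 hs, hermLog_trace hQ.2 hs⟩]
  exact exp_I_smul_hermLog (hs.trans_lt (by norm_num))

end HermLog

/-! ## §2 The untwisted chart of a competitor from the blended comb gauge -/

section T3

variable (F : T3Family) {n K : ℕ} (h : n ≤ K)

/-- ★★ **THE UNTWISTED CHART OF AN ARBITRARY COMPETITOR — rows (i)(ii)(iii) of the E′ text of record.**  `L ≥ 7`; `50(500L + 7L²)·e ≤ 1`, `3306528·e ≤ 1`;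
`W, W′ ∈ (6)(e) ∩ 𝔅_k(V)` (the R2-critical field and a competitor).  Then there is a Hermitian-traceless `D` with `‖D b‖ ≤ 2204352·e·L^{−(K−n)}` on every bond,
`A(W′) = A(e^{iD}W)` and `e^{iD}W ∈ (6)(e) ∩ 𝔅_k(V)` — namely `D = −i log((W′^g)W⁻¹)` for gen 9's blended comb gauge `g` of the pair (`g↓ = 1`).
[cite: Balaban1985Variational, (4)-(6) p.278, (15) p.280, (18) p.280, (112) p.294; Balaban1985RegularSpaces, Lemma 1 p.79] -/
theorem exists_untwistedChart_of_regFibrePr (hL : 7 ≤ F.L) {e : ℝ}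
    (he1 : 50 * (500 * (F.L : ℝ) + 7 * (F.L : ℝ) ^ 2) * e ≤ 1) (he2 : 3306528 * e ≤ 1)
    {V : GaugeField (F.P n) 0 (Matrix.specialUnitaryGroup (Fin 2) ℂ)} (W W' : GaugeField (F.P K) 0 (Matrix.specialUnitaryGroup (Fin 2) ℂ))
    (hW : W ∈ regFibrePr F n K h e V) (hW' : W' ∈ regFibrePr F n K h e V) :
    ∃ D : PBond (F.P K) 0 → Matrix (Fin 2) (Fin 2) ℂ,
      (∀ b : PBond (F.P K) 0, (D b).IsHermitian ∧ Matrix.trace (D b) = 0) ∧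
      (∀ b : PBond (F.P K) 0, ‖D b‖ ≤ 2204352 * e * (((F.L : ℝ))⁻¹) ^ (K - n)) ∧
      wilsonAction4 W' = wilsonAction4 (emb15 W (expHermField D)) ∧
      emb15 W (expHermField D) ∈ regFibrePr F n K h e V := by
  have he0 : 0 < e := pos_of_regPr F ((mem_regFibrePr_iff F).mp hW).2
  have hsmall : 538800 * (e + e) ≤ 1 := by linarith
  obtain ⟨g, -, hgmem, hbound⟩ := exists_blendedGauge_T3 F h hL he1 he1 hsmall W W' hW hW'
  -- the bond ratio `Q_b = (W′^g)_b · W_b⁻¹ ∈ SU(2)` and its distance to `1`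
  set Q : PBond (F.P K) 0 → Matrix.specialUnitaryGroup (Fin 2) ℂ := fun b => GaugeField.gaugeAct g W' b * (W b)⁻¹ with hQdef
  have hQ1 : ∀ b, ‖(Q b : Matrix (Fin 2) (Fin 2) ℂ) - 1‖ ≤ 551088 * (e + e) * (((F.L : ℝ))⁻¹) ^ (K - n) := fun b => hbound b
  have hL0 : (0 : ℝ) < (F.L : ℝ) := by exact_mod_cast (show 0 < F.L by omega)
  have hη1 : (((F.L : ℝ))⁻¹) ^ (K - n) ≤ 1 :=
    pow_le_one₀ (inv_nonneg.mpr hL0.le) (inv_le_one_of_one_le₀ (by exact_mod_cast (show 1 ≤ F.L by omega)))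
  have hη0 : 0 ≤ (((F.L : ℝ))⁻¹) ^ (K - n) := pow_nonneg (inv_nonneg.mpr hL0.le) _
  have hthird : ∀ b, ‖(Q b : Matrix (Fin 2) (Fin 2) ℂ) - 1‖ ≤ 1 / 3 := fun b => by
    refine (hQ1 b).trans ?_
    calc 551088 * (e + e) * (((F.L : ℝ))⁻¹) ^ (K - n) ≤ 551088 * (e + e) * 1 := by gcongr
      _ ≤ 1 / 3 := by linarith
  -- the Hermitian logarithm
  refine ⟨fun b => (-Complex.I) • mlog (Q b : Matrix (Fin 2) (Fin 2) ℂ), fun b => ?_, fun b => ?_, ?_⟩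
  · have hQb := Matrix.mem_specialUnitaryGroup_iff.1 (Q b).2
    exact ⟨hermLog_isHermitian hQb.1 (hthird b), hermLog_trace hQb.2 (hthird b)⟩
  · calc ‖(-Complex.I) • mlog (Q b : Matrix (Fin 2) (Fin 2) ℂ)‖ ≤ 2 * ‖(Q b : Matrix (Fin 2) (Fin 2) ℂ) - 1‖ :=
          norm_hermLog_le ((hthird b).trans (by norm_num))
      _ ≤ 2 * (551088 * (e + e) * (((F.L : ℝ))⁻¹) ^ (K - n)) := by gcongr; exact hQ1 b
      _ = 2204352 * e * (((F.L : ℝ))⁻¹) ^ (K - n) := by ring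
  · -- `e^{iD}·W = W′^g` bondwise
    have hcfg : emb15 W (expHermField fun b => (-Complex.I) • mlog (Q b : Matrix (Fin 2) (Fin 2) ℂ)) = GaugeField.gaugeAct g W' := by
      funext b
      show expHerm ((-Complex.I) • mlog (Q b : Matrix (Fin 2) (Fin 2) ℂ)) * W b = GaugeField.gaugeAct g W' b
      rw [expHerm_hermLog (Q b) (hthird b), hQdef, inv_mul_cancel_right]
    refine ⟨?_, by rw [hcfg]; exact hgmem⟩
    rw [hcfg]
    exact (T4WilsonGaugeFlatDirection.wilsonAction_gaugeAct 1 g W').symm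

/-- ★ **THE SAME IN THE LETTERS OF THE E′ TEXT OF RECORD** (✓`Prop7LocMinOfGaugedRows116Text.stub_PV3E_of_fibreRows` :95–:98): for any `s₀ ≥ 2204352·e`, every
competitor `W′ ∈ (6)(e) ∩ 𝔅_k(V)` has a Hermitian-traceless `D` with `‖D b‖ ≤ s₀·(L^{K−n})⁻¹`, `wilsonAction4 W′ = wilsonAction4 (emb15 W (expHermField D))` and
`emb15 W (expHermField D) ∈ fibre F ℰp n K h V`. [cite: Balaban1985Variational, (141)-(143) p.299, (4)-(6) p.278, (15) p.280, (112) p.294] -/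
theorem exists_untwistedChart_rows (hL : 7 ≤ F.L) {e s₀ : ℝ}
    (he1 : 50 * (500 * (F.L : ℝ) + 7 * (F.L : ℝ) ^ 2) * e ≤ 1) (he2 : 3306528 * e ≤ 1) (hs₀ : 2204352 * e ≤ s₀)
    {V : GaugeField (F.P n) 0 (Matrix.specialUnitaryGroup (Fin 2) ℂ)} (W W' : GaugeField (F.P K) 0 (Matrix.specialUnitaryGroup (Fin 2) ℂ))
    (hW : W ∈ regFibrePr F n K h e V) (hW' : W' ∈ regFibrePr F n K h e V) :
    ∃ D : PBond (F.P K) 0 → Matrix (Fin 2) (Fin 2) ℂ,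
      (∀ b : PBond (F.P K) 0, (D b).IsHermitian ∧ Matrix.trace (D b) = 0) ∧
      (∀ b : PBond (F.P K) 0, ‖D b‖ ≤ s₀ * ((F.L : ℝ) ^ (K - n))⁻¹) ∧
      wilsonAction4 W' = wilsonAction4 (emb15 W (expHermField D)) ∧
      emb15 W (expHermField D) ∈ fibre F ℰp n K h V := by
  obtain ⟨D, hD, hsup, hact, hmem⟩ := exists_untwistedChart_of_regFibrePr F h hL he1 he2 W W' hW hW'
  have hL0 : (0 : ℝ) < (F.L : ℝ) := by exact_mod_cast (show 0 < F.L by omega)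
  refine ⟨D, hD, fun b => (hsup b).trans ?_, hact, ((mem_regFibrePr_iff F).mp hmem).1⟩
  rw [inv_pow]
  exact mul_le_mul_of_nonneg_right hs₀ (inv_nonneg.mpr (pow_nonneg hL0.le _))

end T3

end Summit.QuantumFields.YangMills.Theorems.Prop7UntwistedChartOfBlend

end
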